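import Summits.ValiantsHypothesis.ValiantsHypothesis.Theses.IntegralGCT

/-!
# Census sketch F6a — source/target split of `IntegralFlipQP` through an integral generation
property (crux-strategist, stmt-ValiantsHypothesis-0978). TYPABILITY CHECK ONLY: the two pieces
and the assembly shape elaborate over existing declarations; `transport` is the seam (sorry here).
This family is NOT filed (see STRATEGY-CENSUS.md §F6a: the det piece is refuted in toys via the
Veronese inheritance), it is recorded so a tenure planner can reuse the typed shapes.
-/

set_option linter.unusedVariables false

open Literature.Computability.AlgebraicComplexity

namespace Summit.ValiantsHypothesis.ValiantsHypothesis.Cruxes.IntegralFlipQP.Census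

/-- The integral lattice `Λ(f,d)` of `ℂ[Δ f]_d`, as a subset of the degree piece (classes of
integer homogeneous degree-`d` forms in the coefficient coordinates). -/
def intLattice {σ : Type} [Fintype σ] [DecidableEq σ] (f : MvPolynomial σ ℂ) (m d : ℕ) :
    Set (orbitCoordRingDeg f m d) :=
  {x | ∃ F : MvPolynomial (DegIdx σ m) ℤ, F.IsHomogeneous d ∧
    Ideal.Quotient.mk (orbitVanishingIdeal f m) (MvPolynomial.map (Int.castRingHom ℂ) F) =
      (x : OrbitCoordRing f m)}

/-- `T[k]`-fixed vectors: fixed by every diagonal matrix of `k`-th roots of unity (for weight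
vectors: weight ≡ 0 mod k). A transportable condition (defined through the representation). -/
def torsionTorusFixed {σ : Type} [Fintype σ] [DecidableEq σ] (f : MvPolynomial σ ℂ)
    (m d k : ℕ) : Set (orbitCoordRingDeg f m d) :=
  {x | ∀ (T : GL σ ℂ) (ζ : σ → ℂ), (∀ i, ζ i ^ k = 1) →
    (T : Matrix σ σ ℂ) = Matrix.diagonal ζ → orbitCoordRepDeg f m d T x = x}

/-- `Λ(f,d)` is generated over `ℤ[GL_σ(ℤ)]` by its lattice vectors lying in `C`: every lattice
vector is a `ℤ`-combination of `GL_σ(ℤ)`-translates of lattice vectors in `C`. -/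
def IsIntGeneratedBy {σ : Type} [Fintype σ] [DecidableEq σ] (f : MvPolynomial σ ℂ) (m d : ℕ)
    (C : Set (orbitCoordRingDeg f m d)) : Prop :=
  intLattice f m d ⊆ (Submodule.span ℤ
    {y : orbitCoordRingDeg f m d | ∃ (g : GL σ ℤ) (x : orbitCoordRingDeg f m d),
      x ∈ intLattice f m d ∧ x ∈ C ∧
      y = orbitCoordRepDeg f m d (Matrix.GeneralLinearGroup.map (Int.castRingHom ℂ) g) x} :
        Set (orbitCoordRingDeg f m d))

/-- PIECE X_det (det side, existential/cofinal in the degree): the integral lattice of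
`ℂ[Δ det_m]_{d}` is `GL_{m²}(ℤ)`-generated by its `T[m]`-fixed lattice vectors for infinitely
many degrees `d`. (Toys refute the analogue for the Veronese quotient, hence for det: §F6a.) -/
def DetTorsionTorusGenerated : Prop :=
  ∀ m ≥ 3, ∀ d₀ : ℕ, ∃ d ≥ d₀,
    IsIntGeneratedBy (detPoly (Fin m) ℂ) m d (torsionTorusFixed (detPoly (Fin m) ℂ) m d m)

/-- PIECE X_per (per side, universal/eventual in the degree, inside the qp window): the padded
permanent's lattice is eventually NEVER `T[m]`-generated. -/
def PerTorsionTorusDefect : Prop :=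
  ∀ c : ℕ, ∃ n₀ : ℕ, ∀ n ≥ n₀, ∀ (m : ℕ) [NeZero m], n ≤ m → m ≤ 2 ^ ((Nat.log 2 n + c) ^ c) →
    ∃ D : ℕ, ∀ d ≥ D,
      ¬ IsIntGeneratedBy (paddedPerPoly ℂ n m) m d (torsionTorusFixed (paddedPerPoly ℂ n m) m d m)

/-- THE SEAM (the only mathematics in the assembly): an intertwiner carrying lattice onto lattice
transports `GL(ℤ)`-generation by `T[k]`-fixed lattice vectors from source to target. About 120
lines (span_image, pointwise equivariance for `GL(ℤ) ⊂ GL(ℂ)` and for the torsion torus); left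
as `sorry` in this census sketch. -/
theorem transport {σ : Type} [Fintype σ] [DecidableEq σ] (f g : MvPolynomial σ ℂ) (m d k : ℕ)
    (φ : Representation.IntertwiningMap (orbitCoordRepDeg f m d) (orbitCoordRepDeg g m d))
    (hφ : (fun x => ((φ x : orbitCoordRingDeg g m d) : OrbitCoordRing g m)) ''
          {x | ∃ F : MvPolynomial (DegIdx σ m) ℤ, F.IsHomogeneous d ∧
            Ideal.Quotient.mk (orbitVanishingIdeal f m) (MvPolynomial.map (Int.castRingHom ℂ) F) =
              (x : OrbitCoordRing f m)} =
        {y | ∃ F : MvPolynomial (DegIdx σ m) ℤ, F.IsHomogeneous d ∧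
          Ideal.Quotient.mk (orbitVanishingIdeal g m) (MvPolynomial.map (Int.castRingHom ℂ) F) = y})
    (hf : IsIntGeneratedBy f m d (torsionTorusFixed f m d k)) :
    IsIntGeneratedBy g m d (torsionTorusFixed g m d k) := by
  sorry

/-- ASSEMBLY SHAPE: X_det → X_per → IntegralFlipQP (bookkeeping + `transport`). -/
theorem IntegralFlipQP_of_subs (hdet : DetTorsionTorusGenerated) (hper : PerTorsionTorusDefect) :
    Summit.ValiantsHypothesis.ValiantsHypothesis.Theses.IntegralGCT.IntegralFlipQP := by
  intro c
  obtain ⟨n₀, hn₀⟩ := hper c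
  refine ⟨max n₀ 3, fun n hn m _ hnm hm => ?_⟩
  have hn0 : n₀ ≤ n := (le_max_left _ _).trans hn
  have h3 : 3 ≤ m := ((le_max_right _ _).trans hn).trans hnm
  obtain ⟨D, hD⟩ := hn₀ n hn0 m hnm hm
  obtain ⟨d, hdD, hgen⟩ := hdet m h3 D
  refine ⟨d, ?_⟩
  rintro ⟨φ, hφ⟩
  exact hD d hdD (transport _ _ m d m φ hφ hgen)

end Summit.ValiantsHypothesis.ValiantsHypothesis.Cruxes.IntegralFlipQP.Census
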